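import Literature.AlgebraicGeometry.GroupSchemes.GroupObjectLawsFromCoordinates   -- ★ p844980 (P1): `specOver`, the points currency, `exists_series_of_mul`
import Literature.RingTheory.FormalGroups.NilpotentEvaluationBoxQuotient          -- ★ p845028 (this hand): the `m`-variable box quotients, `evalNilp₂_mk_mk`, `mk_eq_mk_iff_coeff_eq`
import Literature.RingTheory.FormalGroups.FormalOModuleBud                        -- ★ `assocDefect`
import Literature.RingTheory.FormalGroups.FormalGroupOfTruncatedLaws              -- ★ p844917 (A2): `constantCoeff_subst_pair_eq_zero` (and the consumer's `hassoc` shape)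
import HarnessLib

/-!
# Associativity from coordinates: the law series of a group object with natural nilpotent coordinates is ASSOCIATIVE BELOW THE BOX
# ([Tate 1967] §2.2, proof of Prop. 1 — functor-of-points form; the three-variable step)

Topic `Literature/AlgebraicGeometry/GroupSchemes`; namespace `Literature.AlgebraicGeometry.GroupSchemes`.  THEOREMS ONLY (no definition,
no named fact, no instance, no notation, no `sorry`).  Cell `hodgecm-mathlib`, P6 «MOD programme», sub-desk F0P6d, sub-line 2
`Cruxes/HLiu418/Lines/F0_P6d_ConnectedBTDictionary.lean`, letter (HL-D) `ConnectedDimOneIsOModuleLaw` — LEAD-HAND plan σ1 (F0P6-p06) step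
**(P3)**, sequel of ★ `GroupObjectLawsFromCoordinates` (P1) and ★ `GroupObjectBudsFromCoordinates` (P2, every TWO-variable bud axiom).  Given a
group object `G` over `Spec k` with a natural coordinate `c R : (specOver R ⟶ G) ≃ {x : R // x ^ N = 0}` and its law series `P`
(`c (f * f′) = P(c f, c f′)`, ★ `exists_series_of_mul`), ASSOCIATIVITY of the group `Hom(Spec T₃, G)` at the three universal points
`x̄₀, x̄₁, x̄₂` of the THREE-variable test algebra `T₃ = k⟦X₀,X₁,X₂⟧⧸(X₀^N, X₁^N, X₂^N)` gives `P(P(x̄₀,x̄₁),x̄₂) = P(x̄₀,P(x̄₁,x̄₂))` in `T₃`; by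
the bridge ★ `evalNilp₂_mk_mk` both sides are the classes of Mathlib's substitutions `P.subst ![P.subst ![X 0, X 1], X 2]` and
`P.subst ![X 0, P.subst ![X 1, X 2]]`, and equality of classes in `T₃` is equality of the box coefficients (★ `mk_eq_mk_iff_coeff_eq`).
HC_CM is proved only modulo the printed citations until rung 0 closes; nothing here is about HC.

THE PRINT.  [Tate1967] §2.2, proof of Prop. 1: the comultiplications of the layers `A_ν ≅ R[X]⧸(X^{p^{νh}})` of a connected `p`-divisible
group are truncated formal group laws — the group axioms of `G_ν` hold for them modulo the defining ideals.  [Lazard1955] §I Lemme 1 and §II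
(«bourgeons»): truncated laws ∕ congruences modulo degree.

MAIN STATEMENTS.  **`coeff_assoc_eq_of_forall_box`** (box form: the coefficients of `P(P(X,Y),Z)` and `P(X,P(Y,Z))` agree at every
`d : Fin 3 →₀ ℕ` with `d i < N` — the `hassoc` hypothesis shape of ★ `exists_formalGroup_of_truncatedLaws`), **`natCast_le_order_assocDefect`**
(degree form `↑N ≤ order (assocDefect P)` — the `assoc` field of ★ `IsOModuleBud 𝒪 (N − 1) P ρ` for ★ `exists_formalOModuleLaw_of_buds`).

## References
* [Tate1967] J. T. Tate, *p-divisible groups*, Proc. Conf. Local Fields (Driebergen, 1966), Springer (1967) — §2.2, proof of Prop. 1.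
* [Lazard1955] M. Lazard, *Sur les groupes de Lie formels à un paramètre*, Bull. SMF 83 (1955) — §I Lemme 1, §II.
* [BourbakiAlgebraII2003] N. Bourbaki, *Algebra II*, Ch. IV §4 no. 3 (substitution ∕ evaluation of formal power series).
-/

noncomputable section

universe u

open AlgebraicGeometry CategoryTheory MonObj CartesianMonoidalCategory
open Literature.RingTheory.FormalGroups

namespace Literature.AlgebraicGeometry.GroupSchemes

variable {k : Type u} [CommRing k] {G : Over (Spec (.of k))} [GrpObj G] {N : ℕ}
  (c : ∀ (R : Type u) [CommRing R] [Algebra k R], (specOver (A := k) R ⟶ G) ≃ {x : R // x ^ N = 0})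
  {P : MvPowerSeries (Fin 2) k}

/-- **ASSOCIATIVITY BELOW THE BOX (box form).**  For a group object `G` over `Spec k` with a natural coordinate `c` and law series `P`
(`c (f * f′) = P(c f, c f′)`) with `P(0,0) = 0`: the coefficients of `P(P(X₀,X₁),X₂)` and `P(X₀,P(X₁,X₂))` agree at every exponent
`d` with `d i < N` for all `i` — associativity of `Hom(Spec T₃, G)` at the universal points of `T₃ = k⟦X₀,X₁,X₂⟧⧸(X₀^N,X₁^N,X₂^N)`, read
through ★ `evalNilp₂_mk_mk` and ★ `mk_eq_mk_iff_coeff_eq`. [cite: Tate1967, §2.2 (proof of Prop. 1)] [cite: Lazard1955, §I Lemme 1] -/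
theorem coeff_assoc_eq_of_forall_box (h0 : MvPowerSeries.constantCoeff P = 0)
    (hP : ∀ (R : Type u) [CommRing R] [Algebra k R] (f f' : specOver (A := k) R ⟶ G),
      ((c R) (f * f')).1 = evalNilp₂ P ((c R) f).1 ((c R) f').1)
    (d : Fin 3 →₀ ℕ) (hd : ∀ i, d i < N) :
    MvPowerSeries.coeff d (P.subst ![P.subst ![(MvPowerSeries.X 0 : MvPowerSeries (Fin 3) k), MvPowerSeries.X 1], MvPowerSeries.X 2]) =
      MvPowerSeries.coeff d
        (P.subst ![(MvPowerSeries.X 0 : MvPowerSeries (Fin 3) k), P.subst ![(MvPowerSeries.X 1 : MvPowerSeries (Fin 3) k), MvPowerSeries.X 2]]) := by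
  let T := MvPowerSeries (Fin 3) k ⧸ Ideal.span (Set.range fun j : Fin 3 => (MvPowerSeries.X j : MvPowerSeries (Fin 3) k) ^ N)
  have hx : ∀ i : Fin 3, (Ideal.Quotient.mk (Ideal.span (Set.range fun j : Fin 3 => (MvPowerSeries.X j : MvPowerSeries (Fin 3) k) ^ N))
      (MvPowerSeries.X i)) ^ N = 0 := fun i => mk_X_pow_eq_zero_of_range i
  let pt : Fin 3 → (specOver (A := k) T ⟶ G) := fun i => (c T).symm ⟨_, hx i⟩
  have hpt : ∀ i, ((c T) (pt i)).1 =
      Ideal.Quotient.mk (Ideal.span (Set.range fun j : Fin 3 => (MvPowerSeries.X j : MvPowerSeries (Fin 3) k) ^ N))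
        (MvPowerSeries.X i) := fun i => by simp [pt]
  -- associativity of the group `Hom(Spec T₃, G)` at the universal points, read through `c`
  have h := congrArg (fun f : specOver (A := k) T ⟶ G => ((c T) f).1) (mul_assoc (pt 0) (pt 1) (pt 2))
  rw [hP T (pt 0 * pt 1) (pt 2), hP T (pt 0) (pt 1), hP T (pt 0) (pt 1 * pt 2), hP T (pt 1) (pt 2)] at h
  simp only [hpt] at h
  -- the four evaluations are classes of substitutions (★ bridge), and classes agree iff box coefficients agree
  rw [evalNilp₂_mk_X_mk_X P 0 1, evalNilp₂_mk_X_mk_X P 1 2,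
    evalNilp₂_mk_mk P (constantCoeff_subst_pair_eq_zero h0 (MvPowerSeries.constantCoeff_X 0) (MvPowerSeries.constantCoeff_X 1))
      (MvPowerSeries.constantCoeff_X 2),
    evalNilp₂_mk_mk P (MvPowerSeries.constantCoeff_X 0)
      (constantCoeff_subst_pair_eq_zero h0 (MvPowerSeries.constantCoeff_X 1) (MvPowerSeries.constantCoeff_X 2)),
    mk_eq_mk_iff_coeff_eq] at h
  exact h d hd

/-- **ASSOCIATIVITY BELOW THE BOX (degree form): `↑N ≤ order (assocDefect P)`** (★ `FormalOModuleBud.assocDefect P =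
P(P(X₀,X₁),X₂) − P(X₀,P(X₁,X₂))`) — the `assoc` field of ★ `IsOModuleBud 𝒪 (N − 1) P ρ`, completing (with ★ `GroupObjectBudsFromCoordinates`)
the bud axioms of the law and endomorphism series of a group object with natural nilpotent coordinates. [cite: Tate1967, §2.2 (proof of Prop. 1)]
[cite: Lazard1955, §I Lemme 1] -/
theorem natCast_le_order_assocDefect (h0 : MvPowerSeries.constantCoeff P = 0)
    (hP : ∀ (R : Type u) [CommRing R] [Algebra k R] (f f' : specOver (A := k) R ⟶ G),
      ((c R) (f * f')).1 = evalNilp₂ P ((c R) f).1 ((c R) f').1) :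
    (N : ℕ∞) ≤ (assocDefect P).order :=
  natCast_le_order_of_forall_box fun d hd => by
    rw [assocDefect, map_sub, sub_eq_zero]
    exact coeff_assoc_eq_of_forall_box c h0 hP d hd

end Literature.AlgebraicGeometry.GroupSchemes
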